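import Summits.QuantumFields.YangMills.Theorems.UnitScaleTiltProp7LineAvgRightInverse
import HarnessLib

/-!
# Route `UnitScaleTilt`, crux K1 child «MinimiserStabilityRegPr» (stmt-QuantumFields-19200), registered stub `stub_prop7From14` (skeleton birth_v5
# 98cb23610ad7; leaf V3 «Prop 7 from a background (14)») — sub-lemma V3-C (linear core), VECTOR-VALUED FORM: the `k`-uniform right inverse of the
# straight-line `k`-fold block averaging `Q_k = bondAvgIter k` on `(ι → ℝ)`-valued (Lie-algebra-valued, coordinatised) bond fields, coordinate by coordinate

Cell `ym3-torus` ∕ fleet seat `ym-ust-19200-p1` (gen 3).  Companion of `UnitScaleTiltProp7LineAvgRightInverse` (p503703, real scalar fields): the chart fields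
of [Balaban1985Variational] Sect. C are `𝔤`-valued, `𝔤 = su(2)` coordinatised by `ι = Fin 3` (or `M₂(ℂ)` by its `8` real coordinates); the averaging of
record `LatticeFieldCalculus.bondAvgIter k` acts on any real module coordinatewise, so the scalar right inverse `H` applied to each coordinate is a right
inverse with the same `k`-uniform constants `3`, `6L^{kd}`, `18L^{kd}` on the coordinate sums (as in the item's `…FlatCoercivity.sum_sq_le_lineBlockAvg_add_grad_pi`).

WHAT IS PROVED (sorry-free, no definition).  `bondAvgIter_apply_pi` (`(Q_kX)(c)(i) = Q_k(X(·)(i))(c)`), **`exists_rightInverse_bondAvgIter_pi`** (linear `H`,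
`Q_k(HZ) = Z`, `|HZ(b)(i)| ≤ 3·max_{c,i}|Z(c)(i)|`, `Σ_{b,i}|HZ(b)(i)| ≤ 6L^{kd}Σ_{c,i}|Z(c)(i)|`, `Σ_{b,i}(HZ(b)(i))² ≤ 18L^{kd}Σ_{c,i}Z(c)(i)²`),
**`exists_rightInverse_bondAvgIter_pi_T3`** (the d = 3 carrier, `k = K − n`).  [Balaban1985Variational] (45)–(46) at the flat background for the main term,
vector-valued. Nothing of Bałaban's is asserted.

References: T. Bałaban, CMP 102 (1985) 277–309 [Balaban1985Variational] ((45)–(46) p.285); CMP 95 (1984) 17–40 [Balaban1984PropagatorsI] ((1.18) p.20).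
-/

noncomputable section

open scoped BigOperators

namespace Summit.QuantumFields.YangMills.Theorems.Prop7LineAvgRightInverse

open Literature.MathematicalPhysics.QuantumFieldTheory.Balaban1983to89
open Finset LatticeFieldCalculus

variable {P : Params} {k : ℕ} {ι : Type*} [Fintype ι]

omit [Fintype ι] in
/-- The iterated linear average acts coordinatewise on `(ι → ℝ)`-valued bond fields. [cite: Balaban1984PropagatorsI, (1.18) p.20] -/
theorem bondAvgIter_apply_pi (hk : k ≤ P.m + P.K) (X : VecField P 0 (ι → ℝ)) (c : PBond P k) (i : ι) :
    bondAvgIter k X c i = bondAvgIter k (fun b => X b i) c := by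
  rw [Prop7FlatCoercivity.bondAvgIter_eq_lineBlockAvg hk X c, Prop7FlatCoercivity.bondAvgIter_eq_lineBlockAvg hk (fun b => X b i) c]
  simp only [Pi.smul_apply, Finset.sum_apply, smul_eq_mul]

/-- **THE `k`-UNIFORM RIGHT INVERSE OF `Q_k` ON VECTOR-VALUED BOND FIELDS** (coordinatewise application of the scalar right inverse of p503703):
linear `H` with `Q_k(HZ) = Z` and the sup ∕ `ℓ¹` ∕ `ℓ²` bounds with constants `3`, `6L^{kd}`, `18L^{kd}` on the coordinate sums, independent of `k`
and of the volume. [cite: Balaban1985Variational, (45)-(46) p.285] -/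
theorem exists_rightInverse_bondAvgIter_pi (hk : k ≤ P.m + P.K) :
    ∃ H : (PBond P k → ι → ℝ) →ₗ[ℝ] (PBond P 0 → ι → ℝ), ∀ Z : VecField P k (ι → ℝ),
      bondAvgIter k (H Z) = Z ∧
      (∀ B : ℝ, (∀ (c : PBond P k) (i : ι), |Z c i| ≤ B) → ∀ (b : PBond P 0) (i : ι), |H Z b i| ≤ 3 * B) ∧
      (∑ b : PBond P 0, ∑ i, |H Z b i| ≤ 6 * ((P.L : ℝ) ^ k) ^ P.d * ∑ c : PBond P k, ∑ i, |Z c i|) ∧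
      (∑ b : PBond P 0, ∑ i, (H Z b i) ^ 2 ≤ 18 * ((P.L : ℝ) ^ k) ^ P.d * ∑ c : PBond P k, ∑ i, (Z c i) ^ 2) := by
  obtain ⟨H, hH⟩ := exists_rightInverse_bondAvgIter (P := P) hk
  let Hpi : (PBond P k → ι → ℝ) →ₗ[ℝ] (PBond P 0 → ι → ℝ) :=
    { toFun := fun Z b i => H (fun c => Z c i) b
      map_add' := fun Z Z' => by
        funext b i
        have h1 : (fun c => (Z + Z') c i) = (fun c => Z c i) + fun c => Z' c i := rfl
        show H (fun c => (Z + Z') c i) b = H (fun c => Z c i) b + H (fun c => Z' c i) b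
        rw [h1, map_add]
        rfl
      map_smul' := fun a Z => by
        funext b i
        have h1 : (fun c => (a • Z) c i) = a • fun c => Z c i := rfl
        show H (fun c => (a • Z) c i) b = a • H (fun c => Z c i) b
        rw [h1, map_smul]
        rfl }
  refine ⟨Hpi, fun Z => ⟨?_, fun B hB b i => ?_, ?_, ?_⟩⟩
  · funext c i
    rw [bondAvgIter_apply_pi hk]
    exact congrFun (hH (fun c' => Z c' i)).1 c
  · exact (hH (fun c => Z c i)).2.1 B (fun c => hB c i) b
  · have hr : ∑ c : PBond P k, ∑ i, |Z c i| = ∑ i, ∑ c : PBond P k, |Z c i| := Finset.sum_comm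
    rw [Finset.sum_comm, hr, Finset.mul_sum]
    refine Finset.sum_le_sum fun i _ => ?_
    exact (hH (fun c => Z c i)).2.2.1
  · have hr : ∑ c : PBond P k, ∑ i, (Z c i) ^ 2 = ∑ i, ∑ c : PBond P k, (Z c i) ^ 2 := Finset.sum_comm
    rw [Finset.sum_comm, hr, Finset.mul_sum]
    refine Finset.sum_le_sum fun i _ => ?_
    exact (hH (fun c => Z c i)).2.2.2

/-- **AT THE d = 3 CARRIER** (`Site (F.P K) 0`, `k = K − n`): the vector-valued right inverse of `Q_{K−n}` with constants `3`, `6L^{3(K−n)}`, `18L^{3(K−n)}`,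
uniformly in `m`, `n`, `K`. [cite: Balaban1985Variational, (45)-(46) p.285] -/
theorem exists_rightInverse_bondAvgIter_pi_T3 (F : T3ContinuumYM3Torus.T3Family) (n K : ℕ) :
    ∃ H : (PBond (F.P K) (K - n) → ι → ℝ) →ₗ[ℝ] (PBond (F.P K) 0 → ι → ℝ), ∀ Z : VecField (F.P K) (K - n) (ι → ℝ),
      bondAvgIter (K - n) (H Z) = Z ∧
      (∀ B : ℝ, (∀ (c : PBond (F.P K) (K - n)) (i : ι), |Z c i| ≤ B) → ∀ (b : PBond (F.P K) 0) (i : ι), |H Z b i| ≤ 3 * B) ∧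
      (∑ b : PBond (F.P K) 0, ∑ i, |H Z b i| ≤ 6 * ((F.L : ℝ) ^ (K - n)) ^ 3 * ∑ c : PBond (F.P K) (K - n), ∑ i, |Z c i|) ∧
      (∑ b : PBond (F.P K) 0, ∑ i, (H Z b i) ^ 2 ≤ 18 * ((F.L : ℝ) ^ (K - n)) ^ 3 * ∑ c : PBond (F.P K) (K - n), ∑ i, (Z c i) ^ 2) :=
  exists_rightInverse_bondAvgIter_pi (P := F.P K) (show K - n ≤ F.m + K by omega)

end Summit.QuantumFields.YangMills.Theorems.Prop7LineAvgRightInverse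

end
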